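import Summits.Ventures.HSemireg.TensorK3CayleyOguisoLattice
import Summits.Ventures.HSemireg.TensorK3CoxeterToddBridge
/-!
# Venture HSemireg — W3 (N1): the Σ-side of THE CANONICAL BRIDGE (THEOREM K′, w3-jac-1 g18) — closes the kernel leg:
# the by-value data `GK10d`, `R6` of `TensorK3CoxeterToddBridge` ARE the Gram matrix and the `φ*`-matrix of the exceptional
# differences `(V₂−V₁, …, V₆−V₁, H₂−H₁, …, H₆−H₁)` computed from `TensorK3CayleyOguisoLattice.gram` / `.P` (part 1).

HONEST FRAMING as in parts 1–3: integer arithmetic only (`decide +kernel`, 0 sorry); nothing here bears on HC, HC_CM, HC_AV or T1-7d.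
With part 3's `bridge_isometry` (`IMG3·gramCT·IMG3ᵀ = 9·GK10d`) and `bridge_equivariant` (`IMG3·γ² = −R6·IMG3`) this file makes the
statement «Ψ₀ : V_i − V_j ↦ D_(a_i) − D_(a_j), H_i − H_j ↦ γ(D_(a_i) − D_(a_j)) is an isometry from the traceless exceptional classes of
NS(Σ) (form `gram`, automorphism `P`) to NS(S̃) intertwining `φ*` with `−γ²`» a closed chain of kernel-checked identities (×9 scaling at the `W`-level).
-/

namespace Summit.Ventures.HSemireg

namespace TensorK3CoxeterToddBridge

open Matrix hiding gram

/-- The difference basis `Bd` of `K₁₀ ⊗ ℚ`: rows `V_(i+1) − V_1` (`i < 5`, with `V_6` eliminated by (R1) as in part 1) then `H_(j+1) − H_1`,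
in part 1's coordinates `(h₊, h₋, V₁..V₅, H₁..H₆)`. -/
def Bd : Matrix (Fin 10) (Fin 13) ℤ := !![0, 0, -1, 1, 0, 0, 0, 0, 0, 0, 0, 0, 0; 0, 0, -1, 0, 1, 0, 0, 0, 0, 0, 0, 0, 0; 0, 0, -1, 0, 0, 1, 0, 0, 0, 0, 0, 0, 0; 0, 0, -1, 0, 0, 0, 1, 0, 0, 0, 0, 0, 0; 3, -3, -2, -1, -1, -1, -1, 1, 1, 1, 1, 1, 1; 0, 0, 0, 0, 0, 0, 0, -1, 1, 0, 0, 0, 0; 0, 0, 0, 0, 0, 0, 0, -1, 0, 1, 0, 0, 0; 0, 0, 0, 0, 0, 0, 0, -1, 0, 0, 1, 0, 0; 0, 0, 0, 0, 0, 0, 0, -1, 0, 0, 0, 1, 0; 0, 0, 0, 0, 0, 0, 0, -1, 0, 0, 0, 0, 1]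

/-- `GK10d` (part 3, by value) IS the Gram matrix of `Bd` under part 1's `gram`. -/
theorem GK10d_is_gram : Bd * TensorK3CayleyOguisoLattice.gram * Bdᵀ = GK10d := by
  rw [← Matrix.mulᵣ_eq, ← Matrix.mulᵣ_eq]; ext i j; revert i j; decide +kernel

/-- `R6 = [[1,1],[−1,0]] ⊗ 1₅` (part 3, by value) IS `φ*` on the difference basis: `Bd * P = R6 * Bd` (table (Φ1): `φ*(V_i − V_j) =
(V_i − V_j) + (H_i − H_j)`, `φ*(H_i − H_j) = −(V_i − V_j)`). -/
theorem R6_is_phi : Bd * TensorK3CayleyOguisoLattice.P = R6 * Bd := by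
  rw [← Matrix.mulᵣ_eq, ← Matrix.mulᵣ_eq]; ext i j; revert i j; decide +kernel

end TensorK3CoxeterToddBridge

end Summit.Ventures.HSemireg
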